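import Mathlib
import HarnessLib
import Summits.HubbardSuperconductivity.HubbardSuperconductivity.Theorems.KLProgrammeKLRegimeEngineScaleZeroValCPackage
import Summits.HubbardSuperconductivity.HubbardSuperconductivity.Theorems.KLProgrammeKLRegimeEnginePackageSmallnessQ3
import Summits.HubbardSuperconductivity.HubbardSuperconductivity.Theorems.KLProgrammeKLRegimeEngineValueClauseReductionV11G5

/-!
# K3 engine package, coupling threshold v4: `klEngU₀4 P R c := 1/(2^{128}·klEngPsq P⁴·klEngRsq R⁴·(c²+1))` — the threshold below which the
# IN-CLASS (E2″-v7) inequality at `(klEngGeo5, klEngQ5)` follows from (E2-v10) and the history BY NAME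
# (cell gate-hubbard-kl, seat hubbard-kl-k3c2-p2 g6; an ALREADY-TYPED option under plan g14 (R17) PACKAGE-AT-REGISTRATION — read only if the planner rules it in)

`klvr11_pairValueIncrement_inClass_klEngGeo5` (`…ValueClauseReductionV11G5`) discharges the in-class half of (E2″-v7) at the gen-6 package from
(E2-v10) + `PairArrayAtV2 … (n−1)` under the smallness `(C_W + klLegKappa·Q.CR·Klam³)·|U| ≤ 1/10` (the envelope `E = 2|U| + D·U²` of the
previous-scale pair array must stay within `2.1|U|`, because the ladder correction is `E²·bhi/(1−E·bhi)` against the room `(2^28 − 2^24)(Klam U)²`).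
At `Q = klEngQ5 P R` the tolerance constant is `D = C_W + 4000·max(2^60·Psq²Rsq², klScaleZeroValC R)·Klam³ ≤ 2^{123}·Psq⁴·Rsq⁴`, while the v3 threshold
`klEngU₀3 = 2^{-120}/(Psq²·Rsq⁴·(c²+1))` only gives `D·U ≤ 2^3·Psq²` — NOT uniformly small in `P` (lower bound `2^{-48}·Klam³/(Rsq²(c²+1))`).  One more
`Psq²` in the threshold cures it:

* `klEngU₀4 P R c := 1/(2^{128}·klEngPsq P⁴·klEngRsq R⁴·(c²+1))`, `klEngU₀4_pos`, **`klEngU₀4_le_klEngU₀3`** (the monotone door: every closer keyed on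
  `U ≤ klEngU₀3 P R c` lifts by `le_trans`);
* `klEng_pairTolerance5_le` (`D ≤ 2^{123}·Psq⁴·Rsq⁴` at `Q = klEngQ5 P R`, `P.WF`, `R.WF`), **`klEng_pairTolerance5_mul_le_of_le_klEngU₀4`** (`D·|U| ≤ 1/10`, in fact
  `≤ 2^{-5}`), `abs_mul_two_pow_24_le_of_le_klEngU₀3` (`|U|·2^24 ≤ 1/8` already below the v3 threshold);
* **`klvr11_pairValueIncrement_inClass_klEng`** — under EXACTLY the engine's binders with `U ≤ klEngU₀4 P R c` (`P.WF`, `R.WF`, `0 < U`), at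
  `n ≥ 1`: from (E2-v10) `PairLadderStepAtV10 L M klEngGeo5 P (klEngQ5 P R) … n` and the history's `BetaSplitAtS2 … (n−1)` (any `G`; its first conjunct
  is `PairArrayAtV2 … (n−1)`), the (E2″-v7) inequality holds at every `Qm` with `IsPairClassAt L Qm n`.

Arithmetic over the package numerals; nothing about the model is asserted.  The def is a threshold OPTION, not a ruling.
-/

noncomputable section

namespace Summit.HubbardSuperconductivity.HubbardSuperconductivity.Theorems.EngineV8

set_option linter.dupNamespace false -- summit = problem name (single-conjunct summit), D-0017

open Real Finset Literature.MathematicalPhysics.QuantumLattice Literature.Probability.LatticeModels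
open Summit.HubbardSuperconductivity.HubbardSuperconductivity.Theorems.KLRegimeSplit
open Summit.HubbardSuperconductivity.HubbardSuperconductivity.Theorems.KLProgrammeLegKernels

/-! ## §1 The threshold and its door -/

/-- **`klEngU₀4 P R c` — the coupling threshold, v4**: `2^{-128}/(klEngPsq⁴·klEngRsq⁴·(c²+1))`. -/
def klEngU₀4 (P : SplitConsts) (R : RenConsts) (c : ℝ) : ℝ :=
  1 / ((2 : ℝ) ^ 128 * klEngPsq P ^ 4 * klEngRsq R ^ 4 * (c ^ 2 + 1))

/-- `0 < klEngU₀4 P R c`. -/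
theorem klEngU₀4_pos (P : SplitConsts) (R : RenConsts) (c : ℝ) : 0 < klEngU₀4 P R c := by
  unfold klEngU₀4
  have hp := klEngPsq_pos P
  have hr := klEngRsq_pos R
  positivity

/-- **The door**: `klEngU₀4 P R c ≤ klEngU₀3 P R c` (so `U ≤ klEngU₀4 ⇒ U ≤ klEngU₀3` and every v3-keyed closer applies). -/
theorem klEngU₀4_le_klEngU₀3 (P : SplitConsts) (R : RenConsts) (c : ℝ) : klEngU₀4 P R c ≤ klEngU₀3 P R c := by
  unfold klEngU₀4 klEngU₀3
  have hA1 : 1 ≤ klEngPsq P := one_le_klEngPsq P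
  have hr := klEngRsq_pos R
  have hp := klEngPsq_pos P
  refine one_div_le_one_div_of_le (by positivity) ?_
  have h1 : klEngPsq P ^ 2 ≤ klEngPsq P ^ 4 := pow_le_pow_right₀ hA1 (by norm_num)
  have h2 : (2 : ℝ) ^ 120 ≤ 2 ^ 128 := by norm_num
  have h3 : 0 ≤ klEngRsq R ^ 4 * (c ^ 2 + 1) := by positivity
  calc (2 : ℝ) ^ 120 * klEngPsq P ^ 2 * klEngRsq R ^ 4 * (c ^ 2 + 1)
      = (2 : ℝ) ^ 120 * klEngPsq P ^ 2 * (klEngRsq R ^ 4 * (c ^ 2 + 1)) := by ring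
    _ ≤ (2 : ℝ) ^ 128 * klEngPsq P ^ 4 * (klEngRsq R ^ 4 * (c ^ 2 + 1)) := by
        apply mul_le_mul_of_nonneg_right _ h3
        exact mul_le_mul h2 h1 (by positivity) (by positivity)
    _ = (2 : ℝ) ^ 128 * klEngPsq P ^ 4 * klEngRsq R ^ 4 * (c ^ 2 + 1) := by ring

/-- `U ≤ klEngU₀4 P R c → U ≤ klEngU₀3 P R c`. -/
theorem le_klEngU₀3_of_le_klEngU₀4 {P : SplitConsts} {R : RenConsts} {c U : ℝ} (h : U ≤ klEngU₀4 P R c) : U ≤ klEngU₀3 P R c :=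
  h.trans (klEngU₀4_le_klEngU₀3 P R c)

/-! ## §2 The tolerance constant at `klEngQ5` and the two smallnesses -/

/-- `(klEngQ5 P R).CR ≤ 2^{110}·klEngPsq P²·klEngRsq R⁴` (`R.WF`: the `klScaleZeroValC` branch is `≤ 2^{109}·Rsq⁴`). -/
theorem klEngQ5_CR_le {P : SplitConsts} {R : RenConsts} (hR : R.WF) :
    (klEngQ5 P R).CR ≤ (2 : ℝ) ^ 110 * klEngPsq P ^ 2 * klEngRsq R ^ 4 := by
  have hG := hR.2.2
  have hA1 : 1 ≤ klEngPsq P := one_le_klEngPsq P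
  have hB1 : 1 ≤ klEngRsq R := one_le_klEngRsq R
  have hG0 : R.Gfr 0 ≤ klEngRsq R := gfr_le_klEngRsq R (by norm_num)
  have hG2 : R.Gfr 2 ≤ klEngRsq R := gfr_le_klEngRsq R (by norm_num)
  have hV := klScaleZeroValC_le (hG 0) (hG 2)
  have hb : (R.Gfr 0 + 1) * (R.Gfr 2 + 1) ≤ 4 * klEngRsq R ^ 2 := by nlinarith [hG 0, hG 2]
  have hb2 : ((R.Gfr 0 + 1) * (R.Gfr 2 + 1)) ^ 2 ≤ (4 * klEngRsq R ^ 2) ^ 2 :=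
    pow_le_pow_left₀ (by have := hG 0; have := hG 2; positivity) hb 2
  have hV' : klScaleZeroValC R ≤ (2 : ℝ) ^ 109 * klEngRsq R ^ 4 := hV.trans (by nlinarith)
  have hP2 : (1 : ℝ) ≤ klEngPsq P ^ 2 := one_le_pow₀ hA1
  have hR2 : klEngRsq R ^ 2 ≤ klEngRsq R ^ 4 := pow_le_pow_right₀ hB1 (by norm_num)
  have hR4 : 0 ≤ klEngRsq R ^ 4 := by positivity
  show max (2 ^ 60 * klEngPsq P ^ 2 * klEngRsq R ^ 2) (klScaleZeroValC R) ≤ (2 : ℝ) ^ 110 * klEngPsq P ^ 2 * klEngRsq R ^ 4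
  refine max_le ?_ ?_
  · calc (2 : ℝ) ^ 60 * klEngPsq P ^ 2 * klEngRsq R ^ 2 ≤ 2 ^ 60 * klEngPsq P ^ 2 * klEngRsq R ^ 4 :=
          mul_le_mul_of_nonneg_left hR2 (by positivity)
      _ ≤ (2 : ℝ) ^ 110 * klEngPsq P ^ 2 * klEngRsq R ^ 4 := by
          have : 0 ≤ klEngPsq P ^ 2 * klEngRsq R ^ 4 := by positivity
          nlinarith
  · calc klScaleZeroValC R ≤ (2 : ℝ) ^ 109 * klEngRsq R ^ 4 := hV'
      _ = (2 : ℝ) ^ 109 * 1 * klEngRsq R ^ 4 := by ring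
      _ ≤ (2 : ℝ) ^ 109 * klEngPsq P ^ 2 * klEngRsq R ^ 4 := by
          apply mul_le_mul_of_nonneg_right _ hR4
          exact mul_le_mul_of_nonneg_left hP2 (by positivity)
      _ ≤ (2 : ℝ) ^ 110 * klEngPsq P ^ 2 * klEngRsq R ^ 4 := by
          have : 0 ≤ klEngPsq P ^ 2 * klEngRsq R ^ 4 := by positivity
          nlinarith

/-- The v5 tolerance constant is nonnegative (`P.WF`). -/
theorem klEng_pairTolerance5_nonneg {P : SplitConsts} (hP : P.WF) (R : RenConsts) :
    0 ≤ P.C_W + klLegKappa * (klEngQ5 P R).CR * P.Klam ^ 3 := by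
  obtain ⟨hK, hCW, -⟩ := hP
  have hCR : 0 ≤ (klEngQ5 P R).CR := (klEngQ5_wf P R).2.1
  have hK0 : 0 ≤ P.Klam := zero_le_one.trans hK
  unfold klLegKappa
  positivity

/-- **The v5 tolerance constant against the package's polynomial sizes**:
`P.C_W + klLegKappa·(klEngQ5 P R).CR·P.Klam³ ≤ 2^{123}·klEngPsq P⁴·klEngRsq R⁴` (`P.WF`, `R.WF`). -/
theorem klEng_pairTolerance5_le {P : SplitConsts} (hP : P.WF) {R : RenConsts} (hR : R.WF) :
    P.C_W + klLegKappa * (klEngQ5 P R).CR * P.Klam ^ 3 ≤ (2 : ℝ) ^ 123 * klEngPsq P ^ 4 * klEngRsq R ^ 4 := by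
  obtain ⟨hK, hCW, hCd⟩ := hP
  have hA1 : 1 ≤ klEngPsq P := one_le_klEngPsq P
  have hB1 : 1 ≤ klEngRsq R := one_le_klEngRsq R
  have hA0 : 0 ≤ klEngPsq P := zero_le_one.trans hA1
  have hB0 : 0 ≤ klEngRsq R := zero_le_one.trans hB1
  have hK0 : 0 ≤ P.Klam := zero_le_one.trans hK
  -- `C_W ≤ Psq`, `Klam³ ≤ Psq²`
  have hCWA : P.C_W ≤ klEngPsq P := by
    unfold klEngPsq; nlinarith [sq_nonneg (P.C_W - 1), sq_nonneg P.Klam, sq_nonneg P.Cd]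
  have hK2A : P.Klam ^ 2 ≤ klEngPsq P := by
    unfold klEngPsq; nlinarith [sq_nonneg P.C_W, sq_nonneg P.Cd]
  have hK3 : P.Klam ^ 3 ≤ klEngPsq P ^ 2 := by
    calc P.Klam ^ 3 = P.Klam ^ 2 * P.Klam := by ring
      _ ≤ P.Klam ^ 2 * P.Klam ^ 2 := by
          apply mul_le_mul_of_nonneg_left _ (sq_nonneg _)
          nlinarith
      _ = (P.Klam ^ 2) ^ 2 := by ring
      _ ≤ klEngPsq P ^ 2 := pow_le_pow_left₀ (sq_nonneg _) hK2A 2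
  have hCR := klEngQ5_CR_le (P := P) hR
  have hCR0 : 0 ≤ (klEngQ5 P R).CR := (klEngQ5_wf P R).2.1
  unfold klLegKappa
  -- the cubic term
  have h1 : (4000 : ℝ) * (klEngQ5 P R).CR * P.Klam ^ 3 ≤ 2 ^ 122 * klEngPsq P ^ 4 * klEngRsq R ^ 4 := by
    have h4000 : (4000 : ℝ) ≤ 2 ^ 12 := by norm_num
    calc (4000 : ℝ) * (klEngQ5 P R).CR * P.Klam ^ 3
        ≤ 2 ^ 12 * ((2 : ℝ) ^ 110 * klEngPsq P ^ 2 * klEngRsq R ^ 4) * klEngPsq P ^ 2 := by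
          apply mul_le_mul (mul_le_mul h4000 hCR hCR0 (by positivity)) hK3 (by positivity) (by positivity)
      _ = 2 ^ 122 * klEngPsq P ^ 4 * klEngRsq R ^ 4 := by ring
  -- the constant term
  have h2 : P.C_W ≤ 2 ^ 122 * klEngPsq P ^ 4 * klEngRsq R ^ 4 := by
    have h3 : klEngPsq P ≤ klEngPsq P ^ 4 * klEngRsq R ^ 4 := by
      calc klEngPsq P = klEngPsq P * 1 * 1 := by ring
        _ ≤ klEngPsq P * klEngPsq P ^ 3 * klEngRsq R ^ 4 :=
            mul_le_mul (mul_le_mul_of_nonneg_left (one_le_pow₀ hA1) hA0) (one_le_pow₀ hB1) zero_le_one (by positivity)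
        _ = klEngPsq P ^ 4 * klEngRsq R ^ 4 := by ring
    have h4 : klEngPsq P ^ 4 * klEngRsq R ^ 4 ≤ 2 ^ 122 * klEngPsq P ^ 4 * klEngRsq R ^ 4 := by
      have : (0 : ℝ) ≤ klEngPsq P ^ 4 * klEngRsq R ^ 4 := by positivity
      nlinarith
    linarith
  have h2122 : (2 : ℝ) ^ 122 * klEngPsq P ^ 4 * klEngRsq R ^ 4 + 2 ^ 122 * klEngPsq P ^ 4 * klEngRsq R ^ 4
      = 2 ^ 123 * klEngPsq P ^ 4 * klEngRsq R ^ 4 := by ring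
  linarith

/-- **Smallness 1 below the v4 threshold**: `P.WF`, `R.WF`, `0 < U ≤ klEngU₀4 P R c` ⇒
`(P.C_W + klLegKappa·(klEngQ5 P R).CR·P.Klam³)·|U| ≤ 1/10` (in fact `≤ 2^{-5}`). -/
theorem klEng_pairTolerance5_mul_le_of_le_klEngU₀4 {P : SplitConsts} (hP : P.WF) {R : RenConsts} (hR : R.WF) {c U : ℝ} (hU : 0 < U)
    (hU₀ : U ≤ klEngU₀4 P R c) : (P.C_W + klLegKappa * (klEngQ5 P R).CR * P.Klam ^ 3) * |U| ≤ 1 / 10 := by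
  have hD := klEng_pairTolerance5_le hP hR (P := P)
  have hD0 := klEng_pairTolerance5_nonneg hP R
  rw [abs_of_pos hU]
  have hp := klEngPsq_pos P
  have hr := klEngRsq_pos R
  have hX : 0 < (2 : ℝ) ^ 128 * klEngPsq P ^ 4 * klEngRsq R ^ 4 := by positivity
  have hden : (2 : ℝ) ^ 128 * klEngPsq P ^ 4 * klEngRsq R ^ 4 ≤ (2 : ℝ) ^ 128 * klEngPsq P ^ 4 * klEngRsq R ^ 4 * (c ^ 2 + 1) := by
    have h3 : (1 : ℝ) ≤ c ^ 2 + 1 := by nlinarith [sq_nonneg c]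
    calc (2 : ℝ) ^ 128 * klEngPsq P ^ 4 * klEngRsq R ^ 4 = (2 : ℝ) ^ 128 * klEngPsq P ^ 4 * klEngRsq R ^ 4 * 1 := by ring
      _ ≤ _ := mul_le_mul_of_nonneg_left h3 hX.le
  have hUle : U ≤ 1 / ((2 : ℝ) ^ 128 * klEngPsq P ^ 4 * klEngRsq R ^ 4) := by
    refine hU₀.trans ?_
    unfold klEngU₀4
    exact one_div_le_one_div_of_le hX hden
  calc (P.C_W + klLegKappa * (klEngQ5 P R).CR * P.Klam ^ 3) * U
      ≤ ((2 : ℝ) ^ 123 * klEngPsq P ^ 4 * klEngRsq R ^ 4) * (1 / ((2 : ℝ) ^ 128 * klEngPsq P ^ 4 * klEngRsq R ^ 4)) :=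
        mul_le_mul hD hUle hU.le (by positivity)
    _ = 1 / (2 : ℝ) ^ 5 := by field_simp
    _ ≤ 1 / 10 := by norm_num

/-- **Smallness 2 (already below the v3 threshold)**: `0 < U ≤ klEngU₀3 P R c` ⇒ `|U|·2^24 ≤ 1/8`. -/
theorem abs_mul_two_pow_24_le_of_le_klEngU₀3 {P : SplitConsts} {R : RenConsts} {c U : ℝ} (hU : 0 < U) (hU₀ : U ≤ klEngU₀3 P R c) :
    |U| * 2 ^ 24 ≤ 1 / 8 := by
  rw [abs_of_pos hU]
  have hA1 : 1 ≤ klEngPsq P := one_le_klEngPsq P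
  have hB1 : 1 ≤ klEngRsq R := one_le_klEngRsq R
  have hden : (2 : ℝ) ^ 120 ≤ (2 : ℝ) ^ 120 * klEngPsq P ^ 2 * klEngRsq R ^ 4 * (c ^ 2 + 1) := by
    have h1 : (1 : ℝ) ≤ klEngPsq P ^ 2 := one_le_pow₀ hA1
    have h2 : (1 : ℝ) ≤ klEngRsq R ^ 4 := one_le_pow₀ hB1
    have h3 : (1 : ℝ) ≤ c ^ 2 + 1 := by nlinarith [sq_nonneg c]
    calc (2 : ℝ) ^ 120 = 2 ^ 120 * 1 * 1 * 1 := by ring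
      _ ≤ _ := by gcongr
  have hUle : U ≤ 1 / (2 : ℝ) ^ 120 := by
    refine hU₀.trans ?_
    unfold klEngU₀3
    exact one_div_le_one_div_of_le (by positivity) hden
  calc U * 2 ^ 24 ≤ 1 / (2 : ℝ) ^ 120 * 2 ^ 24 := mul_le_mul_of_nonneg_right hUle (by norm_num)
    _ ≤ 1 / 8 := by norm_num

/-- Smallness 2 below the v4 threshold. -/
theorem abs_mul_two_pow_24_le_of_le_klEngU₀4 {P : SplitConsts} {R : RenConsts} {c U : ℝ} (hU : 0 < U) (hU₀ : U ≤ klEngU₀4 P R c) :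
    |U| * 2 ^ 24 ≤ 1 / 8 :=
  abs_mul_two_pow_24_le_of_le_klEngU₀3 hU (le_klEngU₀3_of_le_klEngU₀4 hU₀)

/-! ## §3 In-class (E2″-v7) under the engine's binders at `(klEngGeo5, klEngQ5, klEngU₀4)` -/

section Model

variable {L M : ℕ} [NeZero L] [NeZero M]

/-- **In-class (E2″-v7) at the gen-6 package, BY NAME from the binders**: `P.WF`, `R.WF`, `0 < U ≤ klEngU₀4 P R c`, `1 ≤ n`,
(E2-v10) at `klEngGeo5 / klEngQ5 P R` at scale `n`, and the history's `PairArrayAtV2 … (n−1)` ⇒ the (E2″-v7) inequality at every `Qm` in the pair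
class at resolution `n`. -/
theorem klvr11_pairValueIncrement_inClass_klEng {P : SplitConsts} (hP : P.WF) {R : RenConsts} (hR : R.WF) {c β U μ : ℝ} (hU : 0 < U)
    (hU₀ : U ≤ klEngU₀4 P R c) {K : TrigPolyC4v} {n : ℕ} (hn : 1 ≤ n)
    (hlad : PairLadderStepAtV10 L M klEngGeo5 P (klEngQ5 P R) β U μ K n) (harr : PairArrayAtV2 L M P (klEngQ5 P R) β U μ K (n - 1))
    {Qm : TorusSite 2 L} (hQm : IsPairClassAt L Qm n) :
    ∀ k ∈ klBall L μ K, ∀ k' ∈ klBall L μ K,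
      ‖klPairAmplitude L M β U μ K n Qm k k' - klPairAmplitude L M β U μ K (n - 1) Qm k k'‖ ≤
        gainBar klEngGeo5 P U n (klTorusNorm L Qm) (klTorusNorm L (k - k')) (klTorusNorm L (k + k' - Qm)) +
          eremBar klEngGeo5 P (klEngQ5 P R) U β L (n - 1) + thermalBar klEngGeo5 P U β n +
            legDressBarQ2 klEngGeo5 P (klEngQ5 P R) U n (legSliceCountT L β μ K n ![k', Qm - k', Qm - k, k]) :=
  klvr11_pairValueIncrement_inClass_klEngGeo5 hn hlad harr hQm hP.1 (klEng_pairTolerance5_nonneg hP R)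
    (klEng_pairTolerance5_mul_le_of_le_klEngU₀4 hP hR hU hU₀) (abs_mul_two_pow_24_le_of_le_klEngU₀4 hU hU₀)

/-- The same with the history supplied as the split slot `BetaSplitAtS2 … (n−1)` (any `G`; its first conjunct is `PairArrayAtV2 … (n−1)`). -/
theorem klvr11_pairValueIncrement_inClass_klEng_of_split {P : SplitConsts} (hP : P.WF) {R : RenConsts} (hR : R.WF) {c β U μ : ℝ}
    (hU : 0 < U) (hU₀ : U ≤ klEngU₀4 P R c) {K : TrigPolyC4v} {n : ℕ} (hn : 1 ≤ n)
    (hlad : PairLadderStepAtV10 L M klEngGeo5 P (klEngQ5 P R) β U μ K n) {G : GeoConsts}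
    (hsplit : BetaSplitAtS2 L M G P (klEngQ5 P R) β U μ K (n - 1)) {Qm : TorusSite 2 L} (hQm : IsPairClassAt L Qm n) :
    ∀ k ∈ klBall L μ K, ∀ k' ∈ klBall L μ K,
      ‖klPairAmplitude L M β U μ K n Qm k k' - klPairAmplitude L M β U μ K (n - 1) Qm k k'‖ ≤
        gainBar klEngGeo5 P U n (klTorusNorm L Qm) (klTorusNorm L (k - k')) (klTorusNorm L (k + k' - Qm)) +
          eremBar klEngGeo5 P (klEngQ5 P R) U β L (n - 1) + thermalBar klEngGeo5 P U β n +
            legDressBarQ2 klEngGeo5 P (klEngQ5 P R) U n (legSliceCountT L β μ K n ![k', Qm - k', Qm - k, k]) :=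
  klvr11_pairValueIncrement_inClass_klEng hP hR hU hU₀ hn hlad hsplit.1 hQm

end Model

end Summit.HubbardSuperconductivity.HubbardSuperconductivity.Theorems.EngineV8

end
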